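import Mathlib
import Literature.Analysis.FluidPDE.VorticityCalculus
import Literature.Analysis.FluidPDE.VorticityStretching
import Literature.Analysis.FluidPDE.LambFormCurlKernel
import Literature.Analysis.FluidPDE.DistributionalPressurePoisson
import Literature.Analysis.FluidPDE.NewtonKernel
import Literature.Analysis.FluidPDE.TaoAveragedNondegeneracy
import HarnessLib

/-!
# Crux `PoloidalLiouville` (stmt-NavierStokesRegularity-1222, wall W1), crux idea «steady-centre-sieve» (ns-idea-15 g5,
# `Cruxes/PoloidalLiouville/CentreJetSketch.lean`): the STEADY SLAVING IDENTITY (E5), body VERBATIM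

Support file (Theorems-side; seat ns-wall-eng-7 g4, cell ns-wall-extremal, W1 adjunct; `--supports
stmt-NavierStokesRegularity-1222 --as helper`).  (E5, S) of the steady centre-jet sieve — the steady vorticity equation in toroidal form:
for a classical steady flow on `ℝ³` with `curl V = ∇T × (x − x₀)` off `x₀`, `T ∈ C⁴` off `x₀` and `V ∈ C⁴`,
`∇(ΔT) × (x − x₀) = curl (curl V × V)` off `x₀`.

Proof: `curl V × V = (V·∇)V − ∇(|V|²/2)` (Lamb, Literature `convect_self_eq_cross_curl_add_gradient`), so
`curl(curl V × V) = curl((V·∇)V) = curl(ΔV − ∇p) = Δ(curl V)` (`curl_laplacian`; `∇p = ΔV − (V·∇)V ∈ C¹ ⇒ p ∈ C²`,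
`curl ∇p = 0`); and near `x ≠ x₀`, `curl V = ∇T × (· − x₀)`, whose Laplacian is `Δ(∇T) × (x − x₀) + 2 Σₘ (∂ₘ∇T) × eₘ`
(line second derivatives, `laplacian_cross_sub_const`) `= ∇(ΔT) × (x − x₀)` (the Hessian is symmetric, `Δ∇ = ∇Δ`); the local
`C⁴` hypothesis on `T` is globalised with a smooth bump equal to `1` near `x` and `0` near `x₀`.

* `CentreJet.steadySlavingIdentity` — body of the sketch's `SteadySlavingIdentity` verbatim (`IsSteadyNSOn univ V p` unfolded).

HONEST LABEL: vector calculus about typed objects of one crux idea; the card's conjectures and target, `PoloidalLiouville` (1222) and NS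
regularity remain OPEN and untouched; information-grade (movement 0).  [cite: MajdaBertozziCUP2002, §1.1 (vector identities)]
[cite: MajdaBertozziCUP2002, §2.1 (Lamb form, eq. (2.5))]
-/

-- the summit and its single problem share the name (D-0017 nested layout)
set_option linter.dupNamespace false

noncomputable section

open Set Function Filter
open scoped RealInnerProductSpace Topology
open Literature.Analysis.FluidPDE

namespace Summit.NavierStokesRegularity.NavierStokesRegularity.Theorems.PoloidalLiouville.CentreJet

/-! ### Line calculus for vector-valued fields -/

section Lines

variable {F : Type*} [NormedAddCommGroup F] [NormedSpace ℝ F]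

/-- Second derivative along a line, vector-valued: `D²G(x)(v, v) = (d/dt)²|₀ G(x + t v)` for `G ∈ C²`. -/
theorem iteratedFDeriv_two_line_vec {G : EuclideanSpace ℝ (Fin 3) → F} (hG : ContDiff ℝ 2 G)
    (x v : EuclideanSpace ℝ (Fin 3)) :
    iteratedFDeriv ℝ 2 G x ![v, v] = iteratedDeriv 2 (fun t : ℝ => G (x + t • v)) 0 := by
  have hH : ContDiff ℝ 2 (fun z : EuclideanSpace ℝ (Fin 3) => G (x + z)) := hG.comp (contDiff_const.add contDiff_id)
  have hcomp : (fun t : ℝ => G (x + t • v))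
      = (fun z : EuclideanSpace ℝ (Fin 3) => G (x + z)) ∘ (ContinuousLinearMap.toSpanSingleton ℝ v) := by
    funext t
    simp [ContinuousLinearMap.toSpanSingleton_apply]
  rw [iteratedDeriv_eq_iteratedFDeriv, hcomp,
    (ContinuousLinearMap.toSpanSingleton ℝ v).iteratedFDeriv_comp_right hH 0 (by exact_mod_cast le_rfl),
    ContinuousMultilinearMap.compContinuousLinearMap_apply, iteratedFDeriv_comp_add_left]
  have hv : (![v, v] : Fin 2 → EuclideanSpace ℝ (Fin 3)) = fun _ => (ContinuousLinearMap.toSpanSingleton ℝ v) (1 : ℝ) := by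
    funext i
    fin_cases i <;> simp [ContinuousLinearMap.toSpanSingleton_apply]
  rw [hv]
  simp

/-- The Laplacian of a vector-valued `C²` field from line restrictions: `ΔG(x) = Σₘ (d/dt)²|₀ G(x + t eₘ)`. -/
theorem laplacian_eq_sum_iteratedDeriv_line_vec {G : EuclideanSpace ℝ (Fin 3) → F} (hG : ContDiff ℝ 2 G)
    (x : EuclideanSpace ℝ (Fin 3)) :
    Laplacian.laplacian G x
      = ∑ m : Fin 3, iteratedDeriv 2 (fun t : ℝ => G (x + t • EuclideanSpace.single m (1 : ℝ))) 0 := by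
  rw [InnerProductSpace.laplacian_eq_iteratedFDeriv_orthonormalBasis G (EuclideanSpace.basisFun (Fin 3) ℝ)]
  refine Finset.sum_congr rfl fun m _ => ?_
  rw [EuclideanSpace.basisFun_apply, iteratedFDeriv_two_line_vec hG]

/-- `(d/dt)²|₀ L(G(x + t e)) = L(D²G(x)(e,e))` for a continuous linear `L` and `G ∈ C²`. -/
theorem iteratedDeriv_two_clm_line {G : EuclideanSpace ℝ (Fin 3) → EuclideanSpace ℝ (Fin 3)} (hG : ContDiff ℝ 2 G)
    (L : EuclideanSpace ℝ (Fin 3) →L[ℝ] F) (x e : EuclideanSpace ℝ (Fin 3)) :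
    iteratedDeriv 2 (fun t : ℝ => L (G (x + t • e))) 0 = L (iteratedFDeriv ℝ 2 G x ![e, e]) := by
  have hLG : ContDiff ℝ 2 (fun z => L (G z)) := L.contDiff.comp hG
  rw [← iteratedFDeriv_two_line_vec hLG x e, show (fun z => L (G z)) = L ∘ G from rfl,
    L.iteratedFDeriv_comp_left hG.contDiffAt (i := 2) (by exact_mod_cast le_rfl)]
  simp

/-- `(d/dt)|ₜ L(G(x + s e)) = L(DG(x + t e) e)` for differentiable `G`. -/
theorem hasDerivAt_clm_line {G : EuclideanSpace ℝ (Fin 3) → EuclideanSpace ℝ (Fin 3)} (hG : Differentiable ℝ G)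
    (L : EuclideanSpace ℝ (Fin 3) →L[ℝ] F) (x e : EuclideanSpace ℝ (Fin 3)) (t : ℝ) :
    HasDerivAt (fun s : ℝ => L (G (x + s • e))) (L (fderiv ℝ G (x + t • e) e)) t := by
  have hline : HasDerivAt (fun s : ℝ => x + s • e) e t := by
    simpa using ((hasDerivAt_id t).smul_const e).const_add x
  have hc : HasDerivAt (fun s : ℝ => G (x + s • e)) (fderiv ℝ G (x + t • e) e) t :=
    (hG (x + t • e)).hasFDerivAt.comp_hasDerivAt t hline
  exact L.hasFDerivAt.comp_hasDerivAt t hc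

/-- `(d/dt)²|₀ (t • L(G(x + t e))) = 2 • L(DG(x) e)` for `G ∈ C²`. -/
theorem iteratedDeriv_two_smul_clm_line {G : EuclideanSpace ℝ (Fin 3) → EuclideanSpace ℝ (Fin 3)} (hG : ContDiff ℝ 2 G)
    (L : EuclideanSpace ℝ (Fin 3) →L[ℝ] F) (x e : EuclideanSpace ℝ (Fin 3)) :
    iteratedDeriv 2 (fun t : ℝ => t • L (G (x + t • e))) 0 = (2 : ℝ) • L (fderiv ℝ G x e) := by
  have hGd : Differentiable ℝ G := hG.differentiable (by norm_num)
  set φ : ℝ → F := fun t => L (G (x + t • e)) with hφ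
  have hφd : ∀ t, HasDerivAt φ (L (fderiv ℝ G (x + t • e) e)) t := fun t => hasDerivAt_clm_line hGd L x e t
  have hφ' : deriv φ = fun t => L (fderiv ℝ G (x + t • e) e) := funext fun t => (hφd t).deriv
  have hDG : Differentiable ℝ (fun z => fderiv ℝ G z e) :=
    ((hG.fderiv_right (m := 1) (by norm_num)).differentiable one_ne_zero).clm_apply (differentiable_const _)
  have hφ'd : DifferentiableAt ℝ (deriv φ) 0 := by
    rw [hφ']
    have hline : Differentiable ℝ (fun t : ℝ => x + t • e) :=
      (differentiable_const x).add (differentiable_id.smul_const e)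
    exact (L.differentiable.comp (hDG.comp hline)).differentiableAt
  have h1 : deriv (fun t : ℝ => t • φ t) = fun t => φ t + t • deriv φ t := by
    funext t
    have hmul := (hasDerivAt_id t).smul (hφd t)
    have hfun : (fun s : ℝ => s • φ s) = (id : ℝ → ℝ) • φ := by
      funext s
      rfl
    rw [hfun, hmul.deriv, (hφd t).deriv]
    simp only [one_smul, id_eq]
    exact add_comm _ _
  rw [iteratedDeriv_succ, iteratedDeriv_one, h1]
  have hs : HasDerivAt (fun t : ℝ => t • deriv φ t) (deriv φ 0) 0 := by
    have h := (hasDerivAt_id (0 : ℝ)).smul hφ'd.hasDerivAt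
    have hfun : (fun t : ℝ => t • deriv φ t) = (id : ℝ → ℝ) • deriv φ := by
      funext s
      rfl
    rw [hfun]
    convert h using 1
    simp
  have h2 : HasDerivAt (fun t : ℝ => φ t + t • deriv φ t) (deriv φ 0 + deriv φ 0) 0 :=
    ((hφd 0).differentiableAt.hasDerivAt).add hs
  rw [h2.deriv, hφ']
  simp only [zero_smul, add_zero, two_smul]

end Lines

/-! ### The Laplacian of `G × (· − x₀)` and the toroidal vorticity `∇T × (· − x₀)` -/

/-- **`Δ(G × (· − x₀))(x) = ΔG(x) × (x − x₀) + 2 Σₘ (∂ₘG)(x) × eₘ`** for `G ∈ C²(ℝ³; ℝ³)` (line second derivatives). -/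
theorem laplacian_cross_sub_const {G : EuclideanSpace ℝ (Fin 3) → EuclideanSpace ℝ (Fin 3)} (hG : ContDiff ℝ 2 G)
    (x₀ x : EuclideanSpace ℝ (Fin 3)) :
    Laplacian.laplacian (fun z => cross (G z) (z - x₀)) x
      = cross (Laplacian.laplacian G x) (x - x₀)
        + (2 : ℝ) • ∑ m : Fin 3, cross (fderiv ℝ G x (EuclideanSpace.single m (1 : ℝ))) (EuclideanSpace.single m (1 : ℝ)) := by
  have hF : ContDiff ℝ 2 (fun z => cross (G z) (z - x₀)) :=
    (crossCLM.contDiff.comp hG).clm_apply (contDiff_id.sub contDiff_const)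
  rw [laplacian_eq_sum_iteratedDeriv_line_vec hF x,
    InnerProductSpace.laplacian_eq_iteratedFDeriv_orthonormalBasis G (EuclideanSpace.basisFun (Fin 3) ℝ)]
  -- `a ↦ a × b` as a continuous linear map
  have hflip : ∀ a b : EuclideanSpace ℝ (Fin 3), cross a b = (crossCLM.flip b) a := fun a b => by
    rw [ContinuousLinearMap.flip_apply, crossCLM_apply]
  rw [hflip, map_sum, Finset.smul_sum, ← Finset.sum_add_distrib]
  refine Finset.sum_congr rfl fun m _ => ?_
  rw [EuclideanSpace.basisFun_apply]
  set e : EuclideanSpace ℝ (Fin 3) := EuclideanSpace.single m (1 : ℝ) with he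
  -- split the line function
  have hline2 : ContDiff ℝ 2 (fun t : ℝ => x + t • e) := contDiff_const.add (contDiff_id.smul contDiff_const)
  have hf₁ : ContDiff ℝ 2 (fun t : ℝ => (crossCLM.flip (x - x₀)) (G (x + t • e))) :=
    (crossCLM.flip (x - x₀)).contDiff.comp (hG.comp hline2)
  have hf₂ : ContDiff ℝ 2 (fun t : ℝ => t • (crossCLM.flip e) (G (x + t • e))) :=
    contDiff_id.smul ((crossCLM.flip e).contDiff.comp (hG.comp hline2))
  have hsplit : (fun t : ℝ => cross (G (x + t • e)) (x + t • e - x₀))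
      = (fun t : ℝ => (crossCLM.flip (x - x₀)) (G (x + t • e))) + fun t : ℝ => t • (crossCLM.flip e) (G (x + t • e)) := by
    funext t
    rw [Pi.add_apply, ContinuousLinearMap.flip_apply, ContinuousLinearMap.flip_apply,
      show x + t • e - x₀ = (x - x₀) + t • e by abel, ← crossCLM_apply, map_add, map_smul]
  rw [hsplit, iteratedDeriv_add hf₁.contDiffAt hf₂.contDiffAt, iteratedDeriv_two_clm_line hG, iteratedDeriv_two_smul_clm_line hG,
    hflip (fderiv ℝ G x e) e]

/-- The entries of `D(∇T)(x)`: `(D(∇T)(x) a)ₖ = D²T(x)(a, eₖ)`. -/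
theorem fderiv_gradient_apply_coord (T : EuclideanSpace ℝ (Fin 3) → ℝ) (x a : EuclideanSpace ℝ (Fin 3)) (k : Fin 3) :
    fderiv ℝ (gradient T) x a k = fderiv ℝ (fderiv ℝ T) x a (EuclideanSpace.single k (1 : ℝ)) := by
  have hg : gradient T = (InnerProductSpace.toDual ℝ (EuclideanSpace ℝ (Fin 3))).symm ∘ fderiv ℝ T := rfl
  rw [hg, LinearIsometryEquiv.comp_fderiv, ContinuousLinearMap.comp_apply]
  have h := EuclideanSpace.inner_single_right k (1 : ℝ)
    (((InnerProductSpace.toDual ℝ (EuclideanSpace ℝ (Fin 3))).symm : _ →L[ℝ] _) (fderiv ℝ (fderiv ℝ T) x a))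
  simp only [one_mul, conj_trivial] at h
  rw [← h]
  exact InnerProductSpace.toDual_symm_apply

/-- **The Hessian is symmetric**: `Σₘ (∂ₘ∇T)(x) × eₘ = 0` for `T` of class `C²` at `x`. -/
theorem sum_cross_fderiv_gradient_eq_zero {T : EuclideanSpace ℝ (Fin 3) → ℝ} {x : EuclideanSpace ℝ (Fin 3)}
    (hT : ContDiffAt ℝ 2 T x) :
    ∑ m : Fin 3, cross (fderiv ℝ (gradient T) x (EuclideanSpace.single m (1 : ℝ))) (EuclideanSpace.single m (1 : ℝ)) = 0 := by
  have hs : ∀ a b : EuclideanSpace ℝ (Fin 3), fderiv ℝ (fderiv ℝ T) x a b = fderiv ℝ (fderiv ℝ T) x b a :=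
    fun a b => (hT.isSymmSndFDerivAt (n := 2) (by simp)) a b
  have s01 := hs (EuclideanSpace.single 0 (1 : ℝ)) (EuclideanSpace.single 1 (1 : ℝ))
  have s02 := hs (EuclideanSpace.single 0 (1 : ℝ)) (EuclideanSpace.single 2 (1 : ℝ))
  have s12 := hs (EuclideanSpace.single 1 (1 : ℝ)) (EuclideanSpace.single 2 (1 : ℝ))
  rw [Fin.sum_univ_three]
  ext k
  fin_cases k <;> simp [Tao2016.cross_apply_zero, Tao2016.cross_apply_one, Tao2016.cross_apply_two,
    fderiv_gradient_apply_coord, s01, s02, s12]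


/-! ### A smooth cutoff: globalising a function that is smooth off `x₀` -/

/-- For `x ≠ x₀` and `T ∈ C⁴(ℝ³ ∖ {x₀})` there is a GLOBAL `C⁴` function agreeing with `T` near `x`
(multiply by a smooth bump equal to `1` near `x` and `0` near `x₀`). -/
theorem exists_contDiff_eventuallyEq_of_contDiffOn_compl {T : EuclideanSpace ℝ (Fin 3) → ℝ} {x₀ x : EuclideanSpace ℝ (Fin 3)}
    (hT : ContDiffOn ℝ 4 T {x₀}ᶜ) (hx : x ≠ x₀) :
    ∃ T' : EuclideanSpace ℝ (Fin 3) → ℝ, ContDiff ℝ 4 T' ∧ T' =ᶠ[𝓝 x] T := by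
  have hρ : 0 < dist x x₀ := dist_pos.2 hx
  let χ : ContDiffBump x := ⟨dist x x₀ / 4, dist x x₀ / 2, by positivity, by linarith⟩
  refine ⟨fun z => χ z * T z, ?_, ?_⟩
  · rw [contDiff_iff_contDiffAt]
    intro z
    by_cases hz : z = x₀
    · -- near `x₀` the bump vanishes identically
      have hopen : IsOpen {w : EuclideanSpace ℝ (Fin 3) | dist x x₀ / 2 < dist w x} :=
        isOpen_lt continuous_const (continuous_id.dist continuous_const)
      have hmem : z ∈ {w : EuclideanSpace ℝ (Fin 3) | dist x x₀ / 2 < dist w x} := by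
        rw [hz, Set.mem_setOf_eq, dist_comm x₀ x]
        linarith
      have hev : (fun w => χ w * T w) =ᶠ[𝓝 z] fun _ => 0 := by
        filter_upwards [hopen.mem_nhds hmem] with w hw
        rw [χ.zero_of_le_dist (le_of_lt hw), zero_mul]
      exact contDiffAt_const.congr_of_eventuallyEq hev
    · exact χ.contDiff.contDiffAt.mul (hT.contDiffAt (isOpen_compl_singleton.mem_nhds hz))
  · have hball : Metric.ball x (dist x x₀ / 4) ∈ 𝓝 x := Metric.ball_mem_nhds x (by positivity)
    filter_upwards [hball] with w hw
    rw [χ.one_of_mem_closedBall (Metric.ball_subset_closedBall hw), one_mul]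

/-! ### Assembly -/

/-- ★ **(E5) `SteadySlavingIdentity`, body verbatim** (`IsSteadyNSOn univ V p` unfolded): for a classical steady flow on `ℝ³` with
`curl V = ∇T × (x − x₀)` off `x₀` (`V ∈ C⁴`, `T ∈ C⁴` off `x₀`), `∇(ΔT) × (x − x₀) = curl (curl V × V)` off `x₀`. -/
theorem steadySlavingIdentity :
    ∀ (V : EuclideanSpace ℝ (Fin 3) → EuclideanSpace ℝ (Fin 3)) (p : EuclideanSpace ℝ (Fin 3) → ℝ)
      (T : EuclideanSpace ℝ (Fin 3) → ℝ) (x₀ : EuclideanSpace ℝ (Fin 3)),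
      (ContDiffOn ℝ 3 V univ ∧ ContDiffOn ℝ 1 p univ ∧
          (∀ x ∈ (univ : Set (EuclideanSpace ℝ (Fin 3))), VectorCalculus.divergence V x = 0) ∧
          ∀ x ∈ (univ : Set (EuclideanSpace ℝ (Fin 3))),
            fderiv ℝ V x (V x) + gradient p x = Laplacian.laplacian V x) →
      ContDiff ℝ 4 V → ContDiffOn ℝ 4 T {x₀}ᶜ →
      (∀ x, x ≠ x₀ → curl V x = cross (gradient T x) (x - x₀)) →
      ∀ x, x ≠ x₀ →
        cross (gradient (fun z => Laplacian.laplacian T z) x) (x - x₀) = curl (fun z => cross (curl V z) (V z)) x := by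
  rintro V p T x₀ ⟨-, hp, -, hNS⟩ hV4 hT hcurl x hx
  have hV3 : ContDiff ℝ 3 V := hV4.of_le (by norm_num)
  have hV2 : ContDiff ℝ 2 V := hV4.of_le (by norm_num)
  have hVd : Differentiable ℝ V := hV4.differentiable (by norm_num)
  /- RIGHT-HAND SIDE: `curl (curl V × V) = Δ (curl V)` at `x` -/
  -- smoothness of the players
  have hΔV1 : ContDiff ℝ 1 (Laplacian.laplacian V) := contDiff_laplacian (n := 1) (by exact_mod_cast hV3)
  have hDV2 : ContDiff ℝ 2 (fderiv ℝ V) := hV3.fderiv_right (m := 2) (by norm_num)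
  have hconv1 : ContDiff ℝ 1 (fun z => fderiv ℝ V z (V z)) :=
    (hDV2.of_le (by norm_num)).clm_apply (hV3.of_le (by norm_num))
  have hq4 : ContDiff ℝ 4 (fun y : EuclideanSpace ℝ (Fin 3) => ‖V y‖ ^ 2 / 2) := (hV4.norm_sq ℝ).div_const 2
  have hgq1 : ContDiff ℝ 1 (gradient (fun y : EuclideanSpace ℝ (Fin 3) => ‖V y‖ ^ 2 / 2)) :=
    (InnerProductSpace.toDual ℝ (EuclideanSpace ℝ (Fin 3))).symm.contDiff.comp (hq4.fderiv_right (m := 1) (by norm_num))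
  -- `∇p = ΔV − (V·∇)V`, so `p ∈ C²` and `curl ∇p = 0`
  have hgrad : gradient p = fun z => Laplacian.laplacian V z - fderiv ℝ V z (V z) := by
    funext z
    have h := hNS z (mem_univ z)
    rw [← h]
    abel
  have hgp1 : ContDiff ℝ 1 (gradient p) := by
    rw [hgrad]
    exact hΔV1.sub hconv1
  have hp2 : ContDiff ℝ 2 p := by
    rw [show (2 : WithTop ℕ∞) = 1 + 1 by norm_num, contDiff_succ_iff_fderiv]
    refine ⟨(contDiffOn_univ.1 hp).differentiable one_ne_zero, fun h => absurd h (by simp), ?_⟩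
    have hfd : fderiv ℝ p = fun z => (InnerProductSpace.toDual ℝ (EuclideanSpace ℝ (Fin 3))) (gradient p z) := by
      funext z
      simp [gradient]
    rw [hfd]
    exact (InnerProductSpace.toDual ℝ (EuclideanSpace ℝ (Fin 3))).contDiff.comp hgp1
  -- Lamb form: `curl V × V = (V·∇)V − ∇(|V|²/2)`
  have hLamb : (fun z => cross (curl V z) (V z))
      = fun z => fderiv ℝ V z (V z) - gradient (fun y : EuclideanSpace ℝ (Fin 3) => ‖V y‖ ^ 2 / 2) z := by
    funext z
    have h := convect_self_eq_cross_curl_add_gradient (hVd z)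
    rw [convect_apply] at h
    rw [h]
    abel
  have hRHS : curl (fun z => cross (curl V z) (V z)) x = Laplacian.laplacian (curl V) x := by
    rw [hLamb, curl_sub ((hconv1.differentiable one_ne_zero) x) ((hgq1.differentiable one_ne_zero) x),
      curl_gradient_eq_zero_holds _ (hq4.of_le (by norm_num)) x, sub_zero]
    -- `(V·∇)V = ΔV − ∇p`
    have hconv : (fun z => fderiv ℝ V z (V z)) = fun z => Laplacian.laplacian V z - gradient p z := by
      funext z
      have h := hNS z (mem_univ z)
      rw [← h]
      abel
    rw [hconv, curl_sub ((hΔV1.differentiable one_ne_zero) x) ((hgp1.differentiable one_ne_zero) x),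
      curl_gradient_eq_zero_holds p hp2 x, sub_zero]
    exact curl_laplacian hV3 x
  /- LEFT-HAND SIDE: `Δ (curl V) = ∇(ΔT) × (x − x₀)` at `x`, through a global `C⁴` copy of `T` near `x` -/
  obtain ⟨T', hT', hTT⟩ := exists_contDiff_eventuallyEq_of_contDiffOn_compl hT hx
  -- near `x`, `T' = T` as germs at every point
  have hTTn : ∀ᶠ z in 𝓝 x, T' =ᶠ[𝓝 z] T := hTT.eventually_nhds
  have hgradT : ∀ᶠ z in 𝓝 x, gradient T' z = gradient T z := by
    filter_upwards [hTTn] with z hz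
    rw [gradient, gradient, hz.fderiv_eq]
  have hΔT : (fun z => Laplacian.laplacian T' z) =ᶠ[𝓝 x] fun z => Laplacian.laplacian T z :=
    InnerProductSpace.laplacian_congr_nhds hTT
  have hgradΔ : gradient (fun z => Laplacian.laplacian T' z) x = gradient (fun z => Laplacian.laplacian T z) x := by
    rw [gradient, gradient, hΔT.fderiv_eq]
  -- `curl V = ∇T' × (· − x₀)` near `x`
  have hne : ∀ᶠ z in 𝓝 x, z ≠ x₀ := isOpen_compl_singleton.eventually_mem hx
  have hcurl' : curl V =ᶠ[𝓝 x] fun z => cross (gradient T' z) (z - x₀) := by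
    filter_upwards [hne, hgradT] with z hz hgz
    rw [hcurl z hz, hgz]
  -- regularity of `∇T'`
  have hG3 : ContDiff ℝ 3 (gradient T') :=
    (InnerProductSpace.toDual ℝ (EuclideanSpace ℝ (Fin 3))).symm.contDiff.comp (hT'.fderiv_right (m := 3) (by norm_num))
  have hLHS : Laplacian.laplacian (curl V) x = cross (gradient (fun z => Laplacian.laplacian T z) x) (x - x₀) := by
    rw [(InnerProductSpace.laplacian_congr_nhds hcurl').eq_of_nhds, laplacian_cross_sub_const (hG3.of_le (by norm_num)) x₀ x,
      sum_cross_fderiv_gradient_eq_zero (hT'.contDiffAt.of_le (by norm_num)), smul_zero, add_zero,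
      laplacian_gradient (hT'.of_le (by norm_num)) x, ← hgradΔ]
  rw [← hLHS, hRHS]


end Summit.NavierStokesRegularity.NavierStokesRegularity.Theorems.PoloidalLiouville.CentreJet

end
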